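import Summits.NavierStokesRegularity.NavierStokesRegularity.Theses.EulerMelnikovDss
import Literature.Analysis.FluidPDE.RescaledEulerLeray

/-!
# Birth skeleton — piece `NonlinearPersistence` (stmt-NavierStokesRegularity-18953) of the BC2
  decomposition of `FastBranchProfiles` (stmt-NavierStokesRegularity-1414), route EulerMelnikovDss

Two registered stubs and the kernel-checked composition `NonlinearPersistence_of`, concluding the
ROUTE DECL `Theses.EulerMelnikovDss.NonlinearPersistence` by name (rev 8 of the route file).

* `stub_rescaledBranch` — THE ANALYTIC HEART (L/XL): for every admissible seed `(W, q, P, Q)` with a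
  finite near-1 Floquet cluster at scale `ε`, the `P`-periodic-mod-`Q` Euler orbit `W` persists, along
  a sequence `εₙ → 0⁺`, as classical solutions `(Vₙ, pₙ)` of the rescaled Euler–Leray system
  `∂_σV + V·∇V + ∇p = εₙ(ΔV − ½(V + y·∇V))` on `ℝ × ℝ³`, `Pₙ`-periodic modulo `Qₙ` with `Pₙ → P`,
  uniformly bounded, with the Type-I tail `‖Vₙ(σ, y)‖ ≤ Aₙ/(1 + ‖y‖)`, nontrivial slices, and
  `Vₙ → W` locally uniformly (Lyapunov–Schmidt / Nash–Moser in `ε` on the finite cluster; the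
  seed's selection rules kill the Melnikov integrals of the neutral directions).
* `stub_unrescale` — THE DICTIONARY BACK TO PHYSICAL VARIABLES (M): for `ε > 0`, a classical
  solution `V` of the rescaled system, `Pp`-periodic modulo `Qi`, with the `A/(1+‖y‖)` bound and
  nontrivial slices, gives `u = ofLerayOrbit (amplitudeRescale ε V)` — an ancient mild solution
  (`ν = 1`, measurable slices), rotated-DSS with factor `exp(Pp/(2ε⁻¹))` and isometry `Qi⁻¹`
  (tree: `amplitudeRescale_periodic`, `isRotatedDSS_neg_of_periodic`), with Type-I decay, temporal
  bound `√(−t)‖u‖ ≤ K ε⁻¹` from `‖V‖ ≤ K`, and slices not a.e. zero.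
* `NonlinearPersistence_of` — real proof: `Cₙ := εₙ⁻¹ → ∞` (`tendsto_inv_nhdsGT_zero`), and the
  rescaled-profile formula of the piece, applied to `uₙ`, IS `Vₙ` again
  (`lerayOrbit_ofLerayOrbit` + `amplitudeRescale` algebra), so the convergence transfers.
-/

namespace Summit.NavierStokesRegularity.NavierStokesRegularity.Cruxes.FastBranchProfiles.Birth

open scoped Topology
open Filter Set Function MeasureTheory
open Summit.NavierStokesRegularity.NavierStokesRegularity.Theses.EulerMelnikovDss
open Literature.Analysis.FluidPDE

set_option linter.dupNamespace false

/-- STUB A (the analytic heart): persistence of the seed's periodic orbit in the rescaled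
Euler–Leray variables along a sequence `εₙ → 0⁺`. -/
theorem stub_rescaledBranch : ∀ (W : ℝ → EuclideanSpace ℝ (Fin 3) → EuclideanSpace ℝ (Fin 3)) (q : ℝ → EuclideanSpace ℝ (Fin 3) → ℝ) (P : ℝ) (Q : EuclideanSpace ℝ (Fin 3) ≃ₗᵢ[ℝ] EuclideanSpace ℝ (Fin 3)), 0 < P → Literature.Analysis.FluidPDE.IsClassicalEulerSolutionOn Set.univ 0 W q → (∀ σ y, W (σ + P) (Q y) = Q (W σ y)) → (∃ σ y, W σ y ≠ W 0 y) → (∀ σ, MemLp (W σ) 2 volume) → (∀ k : ℕ, ∃ A : ℝ, ∀ σ y, ‖y‖ ^ k * ‖Literature.Analysis.FluidPDE.curl (W σ) y‖ ≤ A) → (∀ σ, ∫ y, Literature.Analysis.FluidPDE.cross y (Literature.Analysis.FluidPDE.curl (W σ) y) = 0) → (∀ σ, ∫ y, (‖y‖ ^ 2) • Literature.Analysis.FluidPDE.curl (W σ) y = 0) → (∫ σ in (0:ℝ)..P, ∫ y, inner ℝ (Literature.Analysis.FluidPDE.curl (W σ) y) (Literature.Analysis.FluidPDE.curl (Literature.Analysis.FluidPDE.curl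 (W σ)) y) = 0) → (∀ (R : EuclideanSpace ℝ (Fin 3) ≃ₗᵢ[ℝ] EuclideanSpace ℝ (Fin 3)) (a : EuclideanSpace ℝ (Fin 3)), ¬ ∀ σ, Literature.Analysis.FluidPDE.IsAxisymmetric (fun y => R.symm (W σ (R y + a)))) → (∀ C : ℝ, 0 < C → ∃ (m : ℕ) (ε₁ : ℝ), 0 < ε₁ ∧ ∀ ε ∈ Set.Ioo (0:ℝ) ε₁, ∃ M : MeasureTheory.Lp (EuclideanSpace ℝ (Fin 3)) 2 (Literature.Analysis.FluidPDE.weightedMeasure (1 : EuclideanSpace ℝ (Fin 3) → NNReal)) →L[ℝ] MeasureTheory.Lp (EuclideanSpace ℝ (Fin 3)) 2 (Literature.Analysis.FluidPDE.weightedMeasure (1 : EuclideanSpace ℝ (Fin 3) → NNReal)), Literature.Analysis.FluidPDE.IsRescaledEulerLerayMonodromy ε W P Q M ∧ (∀ M', Literature.Analysis.FluidPDE.IsRescaledEulerLerayMonodromy ε W P Q M' → M' = M) ∧ ∃ (C' θ : ℝ), C ≤ C' ∧ C' ≤ 2 * C ∧ 1 / 16 ≤ θ ∧ θ ≤ 1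 / 8 ∧ ∃ N S : Submodule ℝ (MeasureTheory.Lp (EuclideanSpace ℝ (Fin 3)) 2 (Literature.Analysis.FluidPDE.weightedMeasure (1 : EuclideanSpace ℝ (Fin 3) → NNReal))), IsCompl N S ∧ IsClosed (S : Set (MeasureTheory.Lp (EuclideanSpace ℝ (Fin 3)) 2 (Literature.Analysis.FluidPDE.weightedMeasure (1 : EuclideanSpace ℝ (Fin 3) → NNReal)))) ∧ FiniteDimensional ℝ N ∧ Module.finrank ℝ N ≤ m ∧ (∀ x ∈ N, M x ∈ N) ∧ (∀ x ∈ S, M x ∈ S) ∧ (∀ a b : ℝ, (a - 1) ^ 2 + b ^ 2 ≤ (C' * ε) ^ 2 → Real.exp (-(2 * (ε * P * θ))) ≤ a ^ 2 + b ^ 2 → Set.BijOn (fun x => M (M x) - (2 * a) • M x + (a ^ 2 + b ^ 2) • x) S S) ∧ (∀ a b : ℝ, ((C' * ε) ^ 2 ≤ (a - 1) ^ 2 + b ^ 2 ∨ a ^ 2 + b ^ 2 ≤ Real.exp (-(2 * (ε * P * θ)))) → Set.InjOn (fun x => M (M x) - (2 * a) • M x + (a ^ 2 + b ^ 2) • x)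 N)) → ∃ (e Pp : ℕ → ℝ) (Qn : ℕ → (EuclideanSpace ℝ (Fin 3) ≃ₗᵢ[ℝ] EuclideanSpace ℝ (Fin 3))) (V : ℕ → ℝ → EuclideanSpace ℝ (Fin 3) → EuclideanSpace ℝ (Fin 3)) (p : ℕ → ℝ → EuclideanSpace ℝ (Fin 3) → ℝ), (∀ n, 0 < e n) ∧ Tendsto e atTop (𝓝 0) ∧ Tendsto Pp atTop (𝓝 P) ∧ (∀ n, Literature.Analysis.FluidPDE.IsRescaledEulerLeraySolution (e n) (V n) (p n) ∧ (∀ σ y, V n (σ + Pp n) (Qn n y) = Qn n (V n σ y)) ∧ (∃ A : ℝ, ∀ σ y, ‖V n σ y‖ ≤ A / (1 + ‖y‖)) ∧ (∀ σ, ∃ y, V n σ y ≠ 0)) ∧ (∃ K : ℝ, ∀ n σ y, ‖V n σ y‖ ≤ K) ∧ TendstoLocallyUniformly (fun n (z : ℝ × EuclideanSpace ℝ (Fin 3)) => V n z.1 z.2) (uncurry W) atTop := by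
  sorry

/-- STUB B (dictionary): un-rescaling a periodic orbit of the rescaled system with parameter `ε`
gives a nontrivial Type-I rotated-DSS ancient mild solution with factor `exp (Pp / (2 ε⁻¹))`. -/
theorem stub_unrescale : ∀ (ε Pp : ℝ) (Qi : EuclideanSpace ℝ (Fin 3) ≃ₗᵢ[ℝ] EuclideanSpace ℝ (Fin 3)) (V : ℝ → EuclideanSpace ℝ (Fin 3) → EuclideanSpace ℝ (Fin 3)) (p : ℝ → EuclideanSpace ℝ (Fin 3) → ℝ), 0 < ε → Literature.Analysis.FluidPDE.IsRescaledEulerLeraySolution ε V p → (∀ σ y, V (σ + Pp) (Qi y) = Qi (V σ y)) → (∃ A : ℝ, ∀ σ y, ‖V σ y‖ ≤ A / (1 + ‖y‖)) → (∀ σ, ∃ y, V σ y ≠ 0) → Literature.Analysis.FluidPDE.IsAncientMildSolution 1 (Literature.Analysis.FluidPDE.ofLerayOrbit (Literature.Analysis.FluidPDE.amplitudeRescale ε V)) ∧ (∀ t < 0, AEStronglyMeasurable (Literature.Analysis.FluidPDE.ofLerayOrbit (Literature.Analysis.FluidPDE.amplitudeRescale ε V) t) volume) ∧ Literature.Analysis.FluidPDE.IsRotatedDSS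 (Real.exp (Pp / (2 * ε⁻¹))) Qi.symm (Literature.Analysis.FluidPDE.ofLerayOrbit (Literature.Analysis.FluidPDE.amplitudeRescale ε V)) ∧ (∃ C₀ : ℝ, Literature.Analysis.FluidPDE.HasTypeIDecay C₀ (Literature.Analysis.FluidPDE.ofLerayOrbit (Literature.Analysis.FluidPDE.amplitudeRescale ε V))) ∧ (∀ K : ℝ, (∀ σ y, ‖V σ y‖ ≤ K) → ∀ t < 0, ∀ x, Real.sqrt (-t) * ‖Literature.Analysis.FluidPDE.ofLerayOrbit (Literature.Analysis.FluidPDE.amplitudeRescale ε V) t x‖ ≤ K * ε⁻¹) ∧ ¬ (∀ t < 0, Literature.Analysis.FluidPDE.ofLerayOrbit (Literature.Analysis.FluidPDE.amplitudeRescale ε V) t =ᵐ[volume] 0) := by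
  sorry

/-- COMPOSITION (kernel-checked, no sorry): the two stubs give the piece. -/
theorem NonlinearPersistence_of
    (hA : ∀ (W : ℝ → EuclideanSpace ℝ (Fin 3) → EuclideanSpace ℝ (Fin 3)) (q : ℝ → EuclideanSpace ℝ (Fin 3) → ℝ) (P : ℝ) (Q : EuclideanSpace ℝ (Fin 3) ≃ₗᵢ[ℝ] EuclideanSpace ℝ (Fin 3)), 0 < P → Literature.Analysis.FluidPDE.IsClassicalEulerSolutionOn Set.univ 0 W q → (∀ σ y, W (σ + P) (Q y) = Q (W σ y)) → (∃ σ y, W σ y ≠ W 0 y) → (∀ σ, MemLp (W σ) 2 volume) → (∀ k : ℕ, ∃ A : ℝ, ∀ σ y, ‖y‖ ^ k * ‖Literature.Analysis.FluidPDE.curl (W σ) y‖ ≤ A) → (∀ σ, ∫ y, Literature.Analysis.FluidPDE.cross y (Literature.Analysis.FluidPDE.curl (W σ) y) = 0) → (∀ σ, ∫ y, (‖y‖ ^ 2) • Literature.Analysis.FluidPDE.curl (W σ) y = 0) → (∫ σ in (0:ℝ)..P, ∫ y, inner ℝ (Literature.Analysis.FluidPDE.curl (W σ) y) (Literature.Analysis.FluidPDE.curl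 (Literature.Analysis.FluidPDE.curl (W σ)) y) = 0) → (∀ (R : EuclideanSpace ℝ (Fin 3) ≃ₗᵢ[ℝ] EuclideanSpace ℝ (Fin 3)) (a : EuclideanSpace ℝ (Fin 3)), ¬ ∀ σ, Literature.Analysis.FluidPDE.IsAxisymmetric (fun y => R.symm (W σ (R y + a)))) → (∀ C : ℝ, 0 < C → ∃ (m : ℕ) (ε₁ : ℝ), 0 < ε₁ ∧ ∀ ε ∈ Set.Ioo (0:ℝ) ε₁, ∃ M : MeasureTheory.Lp (EuclideanSpace ℝ (Fin 3)) 2 (Literature.Analysis.FluidPDE.weightedMeasure (1 : EuclideanSpace ℝ (Fin 3) → NNReal)) →L[ℝ] MeasureTheory.Lp (EuclideanSpace ℝ (Fin 3)) 2 (Literature.Analysis.FluidPDE.weightedMeasure (1 : EuclideanSpace ℝ (Fin 3) → NNReal)), Literature.Analysis.FluidPDE.IsRescaledEulerLerayMonodromy ε W P Q M ∧ (∀ M', Literature.Analysis.FluidPDE.IsRescaledEulerLerayMonodromy ε W P Q M' → M' = M) ∧ ∃ (C' θ : ℝ), C ≤ C' ∧ C' ≤ 2 * C ∧ 1 / 16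 ≤ θ ∧ θ ≤ 1 / 8 ∧ ∃ N S : Submodule ℝ (MeasureTheory.Lp (EuclideanSpace ℝ (Fin 3)) 2 (Literature.Analysis.FluidPDE.weightedMeasure (1 : EuclideanSpace ℝ (Fin 3) → NNReal))), IsCompl N S ∧ IsClosed (S : Set (MeasureTheory.Lp (EuclideanSpace ℝ (Fin 3)) 2 (Literature.Analysis.FluidPDE.weightedMeasure (1 : EuclideanSpace ℝ (Fin 3) → NNReal)))) ∧ FiniteDimensional ℝ N ∧ Module.finrank ℝ N ≤ m ∧ (∀ x ∈ N, M x ∈ N) ∧ (∀ x ∈ S, M x ∈ S) ∧ (∀ a b : ℝ, (a - 1) ^ 2 + b ^ 2 ≤ (C' * ε) ^ 2 → Real.exp (-(2 * (ε * P * θ))) ≤ a ^ 2 + b ^ 2 → Set.BijOn (fun x => M (M x) - (2 * a) • M x + (a ^ 2 + b ^ 2) • x) S S) ∧ (∀ a b : ℝ, ((C' * ε) ^ 2 ≤ (a - 1) ^ 2 + b ^ 2 ∨ a ^ 2 + b ^ 2 ≤ Real.exp (-(2 * (ε * P * θ)))) → Set.InjOn (fun x => M (M x) - (2 * a) • M x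 + (a ^ 2 + b ^ 2) • x) N)) → ∃ (e Pp : ℕ → ℝ) (Qn : ℕ → (EuclideanSpace ℝ (Fin 3) ≃ₗᵢ[ℝ] EuclideanSpace ℝ (Fin 3))) (V : ℕ → ℝ → EuclideanSpace ℝ (Fin 3) → EuclideanSpace ℝ (Fin 3)) (p : ℕ → ℝ → EuclideanSpace ℝ (Fin 3) → ℝ), (∀ n, 0 < e n) ∧ Tendsto e atTop (𝓝 0) ∧ Tendsto Pp atTop (𝓝 P) ∧ (∀ n, Literature.Analysis.FluidPDE.IsRescaledEulerLeraySolution (e n) (V n) (p n) ∧ (∀ σ y, V n (σ + Pp n) (Qn n y) = Qn n (V n σ y)) ∧ (∃ A : ℝ, ∀ σ y, ‖V n σ y‖ ≤ A / (1 + ‖y‖)) ∧ (∀ σ, ∃ y, V n σ y ≠ 0)) ∧ (∃ K : ℝ, ∀ n σ y, ‖V n σ y‖ ≤ K) ∧ TendstoLocallyUniformly (fun n (z : ℝ × EuclideanSpace ℝ (Fin 3)) => V n z.1 z.2) (uncurry W) atTop)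
    (hB : ∀ (ε Pp : ℝ) (Qi : EuclideanSpace ℝ (Fin 3) ≃ₗᵢ[ℝ] EuclideanSpace ℝ (Fin 3)) (V : ℝ → EuclideanSpace ℝ (Fin 3) → EuclideanSpace ℝ (Fin 3)) (p : ℝ → EuclideanSpace ℝ (Fin 3) → ℝ), 0 < ε → Literature.Analysis.FluidPDE.IsRescaledEulerLeraySolution ε V p → (∀ σ y, V (σ + Pp) (Qi y) = Qi (V σ y)) → (∃ A : ℝ, ∀ σ y, ‖V σ y‖ ≤ A / (1 + ‖y‖)) → (∀ σ, ∃ y, V σ y ≠ 0) → Literature.Analysis.FluidPDE.IsAncientMildSolution 1 (Literature.Analysis.FluidPDE.ofLerayOrbit (Literature.Analysis.FluidPDE.amplitudeRescale ε V)) ∧ (∀ t < 0, AEStronglyMeasurable (Literature.Analysis.FluidPDE.ofLerayOrbit (Literature.Analysis.FluidPDE.amplitudeRescale ε V) t) volume) ∧ Literature.Analysis.FluidPDE.IsRotatedDSS (Real.exp (Pp / (2 * ε⁻¹))) Qi.symm (Literature.Analysis.FluidPDE.ofLerayOrbit (Literature.Analysis.FluidPDE.amplitudeRescale ε V)) ∧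 (∃ C₀ : ℝ, Literature.Analysis.FluidPDE.HasTypeIDecay C₀ (Literature.Analysis.FluidPDE.ofLerayOrbit (Literature.Analysis.FluidPDE.amplitudeRescale ε V))) ∧ (∀ K : ℝ, (∀ σ y, ‖V σ y‖ ≤ K) → ∀ t < 0, ∀ x, Real.sqrt (-t) * ‖Literature.Analysis.FluidPDE.ofLerayOrbit (Literature.Analysis.FluidPDE.amplitudeRescale ε V) t x‖ ≤ K * ε⁻¹) ∧ ¬ (∀ t < 0, Literature.Analysis.FluidPDE.ofLerayOrbit (Literature.Analysis.FluidPDE.amplitudeRescale ε V) t =ᵐ[volume] 0)) :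
    NonlinearPersistence := by
  intro W q P Q hP hE hper hnt hL2 hdec hI hAng hH hax hcl
  obtain ⟨e, Pp, Qn, V, p, hepos, he0, hPp, hsol, ⟨K, hK⟩, hconv⟩ :=
    hA W q P Q hP hE hper hnt hL2 hdec hI hAng hH hax hcl
  -- amplitudes C n := (e n)⁻¹ → ∞
  have heGT : Tendsto e atTop (𝓝[>] (0:ℝ)) :=
    tendsto_nhdsWithin_iff.2 ⟨he0, Eventually.of_forall fun n => hepos n⟩
  have hC : Tendsto (fun n => (e n)⁻¹) atTop atTop := tendsto_inv_nhdsGT_zero.comp heGT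
  refine ⟨K, fun n => (e n)⁻¹, Pp, fun n => (Qn n).symm,
    fun n => ofLerayOrbit (amplitudeRescale (e n) (V n)), fun n => inv_pos.2 (hepos n), hC, hPp,
    fun n => ?_, ?_⟩
  · obtain ⟨hs, hperV, hAV, hnz⟩ := hsol n
    obtain ⟨hmild, hmeas, hdss, hTI, hamp, hnontriv⟩ := hB (e n) (Pp n) (Qn n) (V n) (p n)
      (hepos n) hs hperV hAV hnz
    exact ⟨hmild, hmeas, hdss, hTI, hamp K (hK n), hnontriv⟩
  · -- the rescaled-profile formula applied to u n is V n again
    have key : (fun n (z : ℝ × EuclideanSpace ℝ (Fin 3)) => ((e n)⁻¹)⁻¹ •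
        (Real.exp (-(z.1 / (e n)⁻¹) / 2) •
          ofLerayOrbit (amplitudeRescale (e n) (V n)) (-Real.exp (-(z.1 / (e n)⁻¹)))
            (Real.exp (-(z.1 / (e n)⁻¹) / 2) • z.2))) =
        fun n (z : ℝ × EuclideanSpace ℝ (Fin 3)) => V n z.1 z.2 := by
      funext n z
      have hen : e n ≠ 0 := (hepos n).ne'
      have h1 : Real.exp (-(z.1 / (e n)⁻¹) / 2) •
          ofLerayOrbit (amplitudeRescale (e n) (V n)) (-Real.exp (-(z.1 / (e n)⁻¹)))
            (Real.exp (-(z.1 / (e n)⁻¹) / 2) • z.2) =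
          amplitudeRescale (e n) (V n) (z.1 / (e n)⁻¹) z.2 := by
        rw [← lerayOrbit_apply, lerayOrbit_ofLerayOrbit]
      rw [h1, amplitudeRescale_apply, smul_smul, inv_inv, mul_inv_cancel₀ hen, one_smul]
      congr 1
      field_simp
    rw [key]
    exact hconv

end Summit.NavierStokesRegularity.NavierStokesRegularity.Cruxes.FastBranchProfiles.Birth
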